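-- line stmt-HodgeConjecture-18881 Cruxes/BlochSeedDiscOne/Lines/birth.lean 814a6a70c14e831a stub_rung_pad4_seedAt
import Mathlib

/-!
# LEMMA M3 — linear-algebra core (hsemireg-alphabet-unipotent-1, g19)

Kernel-checked form of the one linear-algebra step of LEMMA M3 (memo `U-MIX-unipotent1-g19.md` §3):
if the classes `ω t` (there: the 7 products `[e_t · σ_z] ∈ H²(X, 𝒪_X)`) are linearly independent and
`∑ t, ω t ⊗ M t = 0` (there: the `(a₁,a₁)`-component of the `d₁`-cocycle condition, `M t = C_t · I_{a₁→x_A}`),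
then every `M t = 0` — so every `δ₂` term out of the block, which carries the factor `C_t · I`, vanishes.
The geometry (which classes, why independent, why no other block interferes) is NOT formalised here.
Nothing here is proved toward HC / HC_CM / HC_AV / №4 / 26512 / 18881 / H2.
-/

open TensorProduct Module

namespace HsemiregUnipotent1.G19.M3

variable {K V W ι : Type*} [Field K] [AddCommGroup V] [Module K V] [AddCommGroup W] [Module K W]

/-- contraction of `V ⊗ W` against a functional on `V`. -/
noncomputable def contractLeft (W : Type*) [AddCommGroup W] [Module K W] (φ : Module.Dual K V) :
    V ⊗[K] W →ₗ[K] W :=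
  (TensorProduct.lid K W).toLinearMap ∘ₗ (φ.rTensor W)

@[simp] theorem contractLeft_tmul (φ : Module.Dual K V) (v : V) (w : W) :
    contractLeft W φ (v ⊗ₜ[K] w) = φ v • w := by
  simp [contractLeft]

/-- over a field, a linearly independent family has a dual family of functionals. -/
theorem exists_dual_family (ω : ι → V) (hω : LinearIndependent K ω) (t₀ : ι) [DecidableEq ι] :
    ∃ φ : Module.Dual K V, ∀ s, φ (ω s) = if s = t₀ then 1 else 0 := by
  let b := Basis.span hω
  obtain ⟨g, hg⟩ := LinearMap.exists_extend (b.coord t₀)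
  refine ⟨g, fun s => ?_⟩
  have hmem : ω s ∈ Submodule.span K (Set.range ω) := Submodule.subset_span ⟨s, rfl⟩
  have h1 : g (ω s) = b.coord t₀ ⟨ω s, hmem⟩ := by
    have := LinearMap.congr_fun hg ⟨ω s, hmem⟩
    simpa using this
  have h2 : (⟨ω s, hmem⟩ : Submodule.span K (Set.range ω)) = b s := by
    apply Subtype.ext
    simp [b, Basis.span_apply]
  rw [h1, h2]
  simp [Finsupp.single_apply]

/-- **M3 core.** `∑ t, ω t ⊗ M t = 0` with `ω` linearly independent forces every `M t = 0`. -/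
theorem eq_zero_of_sum_tmul_eq_zero [Fintype ι] (ω : ι → V) (hω : LinearIndependent K ω)
    (M : ι → W) (h : ∑ t, ω t ⊗ₜ[K] M t = 0) : ∀ t, M t = 0 := by
  classical
  intro t₀
  obtain ⟨φ, hφ⟩ := exists_dual_family ω hω t₀
  have := congrArg (contractLeft W φ) h
  simp only [map_sum, contractLeft_tmul, hφ, map_zero, ite_smul, one_smul, zero_smul,
    Finset.sum_ite_eq', Finset.mem_univ, if_true] at this
  exact this

/-- the matrix instance used in memo §3: seven independent classes against `N_a × N_a` matrices
(any sizes): `∑ t, [e_t σ] ⊗ (C_t I) = 0 ⇒ C_t I = 0` for each of the seven Künneth types `t`. -/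
theorem M3_matrix_form {m n : ℕ} (ω : Fin 7 → V) (hω : LinearIndependent K ω)
    (CI : Fin 7 → Matrix (Fin m) (Fin n) K) (h : ∑ t, ω t ⊗ₜ[K] CI t = 0) (t : Fin 7) : CI t = 0 :=
  eq_zero_of_sum_tmul_eq_zero ω hω CI h t

/-- consequently every term of the shape `g ⊗ (P · (C_t I))` (the `δ₂` terms of memo §3, proof steps (A), (B))
vanishes, whatever the geometric coefficient `g` and the matrix `P`. -/
theorem delta2_terms_vanish {l m n : ℕ} (ω : Fin 7 → V) (hω : LinearIndependent K ω)
    (CI : Fin 7 → Matrix (Fin m) (Fin n) K) (h : ∑ t, ω t ⊗ₜ[K] CI t = 0)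
    (P : Matrix (Fin l) (Fin m) K) (g : Fin 7 → W) :
    ∑ t, g t ⊗ₜ[K] (P * CI t) = 0 := by
  simp [M3_matrix_form ω hω CI h]

end HsemiregUnipotent1.G19.M3
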